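import Summits.BirchSwinnertonDyer.BirchSwinnertonDyer.Theorems.AlignedTransportAtTwoMainConjectureOfRankZeroBSDAtTwoFineRoadRealKummerOrdinary
import Summits.BirchSwinnertonDyer.BirchSwinnertonDyer.Theorems.AlignedTransportAtTwoMainConjectureOfRankZeroBSDAtTwoFineRoadRealKummerHom
import HarnessLib

/-!
# A Greenberg–Vatsal transfer at `p = 2` on the `Δ > 0` half-cell, in `E[2]`-currency: a `Γ_ℚ`-isomorphism `ψ : W[2] ≃ W′[2]` that
# matches the two LETTERS (the 2-adic line `C₂[2]` and the real Kummer letter `T_min`) identifies the two explicit `E[2]`-Selmer groups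
# `Q_Gr` over `ℚ_∞`; hence «`X(W/ℚ_∞)` torsion with `μ₂ = 0`» ⟺ «`X(W′/ℚ_∞)` torsion with `μ₂ = 0`» modulo the printed `im κ_𝔭 ⊇ L_𝔭`

Cell `bsd-f1-sign2`, WIDTH-5 attach seat `bsd-line-att-p5` (gen 10) on line `birth` of crux C2 stmt-BirchSwinnertonDyer-22298
`MainConjectureOfRankZeroBSDAtTwo`; sequel of `…FineRoadRealKummerOrdinary` (att-p5 g10). A `--supports 22298 --as helper` file. HONEST
FRAMING: THEOREMS ONLY — no definition, no named fact, no `sorry`; C2-NEUTRAL (stub T stays OPEN); BSD is NOT proved by any of this.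

WHY. Greenberg–Vatsal 2000 (Thm. 1.4, `p` ODD): for `E[p] ≅ E′[p]`, `μ(E) = 0 ⟺ μ(E′) = 0`, because the residual Selmer group
`Sel(ℚ_∞, E[p])` (Greenberg's condition at `p`, nothing at `∞`) depends only on the Galois module. At `p = 2` on `Δ > 0` the residual
group `Q_Gr` of `RealKummerOrdinary` carries TWO pieces of non-module data: the line `C₂[2] ⊂ E[2]` at `2` and the Kummer letter
`T_w = T_min ∈ E[2]` at `∞` (crux workfile §9: the real letter FLIPS under negative twists). This file proves the transfer WITH the
letters as hypotheses:
* §1 transport along a `Γ`-equivariant `ψ : M → M′` of the three kinds of local condition: locally trivial (`resOfLe_conjH1_resH1Hom_id_eq_zero`,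
  any hom; `…_iff` for an iso), Greenberg's inertia-form condition (att-p5 g10 `RealKummerOrdinary.resH1Hom_id_mem_greenbergKer_iff`,
  needs `ψ(plus) = plus′`), the real evaluation (`evalH1_resOfLe_conjH1_resH1Hom_id`: `ev_w(conj_σ ψ_* y) = ψ(ev_w(conj_σ y))`, needs
  `ψ T_w = T′_w`).
* §2 **`mem_iff_of_torsionIso`** (`y ∈ Q_Gr(W) ⟺ ψ_* y ∈ Q_Gr(W′)`) and **`finite_iff_of_torsionIso`** (`Q_Gr(W)` finite ⟺ `Q_Gr(W′)` finite)
  for an equivariant iso `ψ : W[2] ≃+ W′[2]` with `ψ(C₂[2]) = C₂′[2]` and `ψ T_w = T′_w`.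
* §3 **`finite_twoTorsion_selmerInfty_of_finite_of_torsionIso`** (kernel: `Q_Gr(W′)` finite ⟹ `Sel_{2^∞}(W/ℚ_∞)[2]` finite) and
  **`finite_twoTorsion_selmerInfty_iff_of_torsionIso_of_GV`** (mod `GreenbergVatsal2000.imKummer_ge_greenbergCondition_at_p`, both curves
  globally minimal, good ordinary at `2`, `Δ > 0`: `Sel_{2^∞}(W/ℚ_∞)[2]` finite ⟺ `Sel_{2^∞}(W′/ℚ_∞)[2]` finite — i.e. «torsion ∧ μ₂ = 0»
  transfers along LETTER-PRESERVING 2-congruences).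

References: R. Greenberg, V. Vatsal, Invent. Math. 142 (2000) Thm. 1.4, §2; R. Greenberg, LNM 1716 (1999) §2, §5 p. 168; M. Emerton, R. Pollack,
T. Weston, Invent. Math. 163 (2006) §3–4; crux workfile `RELAXED-COEFFICIENTS-att-p5.md` §9 (cell bsd-f1-sign2).
-/

set_option autoImplicit false
-- the Theorems namespace of this sub repeats the summit name by design (D-0017 nested layout)
set_option linter.dupNamespace false

noncomputable section

open scoped Classical

namespace Summit.BirchSwinnertonDyer.BirchSwinnertonDyer.Theorems.AlignedTransportAtTwoFineRoad.RealKummerCongruence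

open WeierstrassCurve NumberField IsDedekindDomain Field Literature.NumberTheory.EllipticCurves
  Literature.NumberTheory.EllipticCurves.GreenbergSelmer Literature.NumberTheory.GaloisRepresentations
  Literature.NumberTheory.EllipticCurves.FineSelmerCoefficientMap
  Summit.BirchSwinnertonDyer.BirchSwinnertonDyer.Theorems.AlignedTransportAtTwoFineRoad
  Summit.BirchSwinnertonDyer.Rank1Residual.X2 Summit.BirchSwinnertonDyer.Rank1Residual.X2.GreenbergVatsalReductionDatum

/-! ## §1 Transport of local conditions along an equivariant map of coefficients -/

section Transport

variable {K : Type} [Field K] [NumberField K] (H : Subgroup (absoluteGaloisGroup K)) [H.Normal]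
  {M : Type} [AddCommGroup M] [DistribMulAction (absoluteGaloisGroup K) M] [TopologicalSpace M] [DiscreteTopology M]
  {M' : Type} [AddCommGroup M'] [DistribMulAction (absoluteGaloisGroup K) M'] [TopologicalSpace M'] [DiscreteTopology M']

omit [NumberField K] in
/-- **«Locally trivial» is transported by any equivariant `ψ : M → M′`**: if `conj_σ c` restricts to zero on `H ⊓ D` then so does
`conj_σ (ψ_* c)` (`ψ_*` commutes with `conj_σ` and with restriction). [cite: SerreGaloisCohomology1997, I §2.4–2.5] -/
theorem resOfLe_conjH1_resH1Hom_id_eq_zero (ψ : M →+ M') (hψ' : ∀ (g : absoluteGaloisGroup K) (m : M), ψ (g • m) = g • ψ m)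
    (hψ : ∀ (x : H) (m : M), ψ (ContinuousMonoidHom.id H x • m) = x • ψ m) (D : Subgroup (absoluteGaloisGroup K))
    (σ : absoluteGaloisGroup K) {c : subgroupH1 H M}
    (hc : resOfLe M (inf_le_left : H ⊓ D ≤ H) (conjH1 H M σ c) = 0) :
    resOfLe M' (inf_le_left : H ⊓ D ≤ H) (conjH1 H M' σ (resH1Hom (ContinuousMonoidHom.id H) ψ hψ c)) = 0 := by
  have hconj : conjH1 H M' σ (resH1Hom (ContinuousMonoidHom.id H) ψ hψ c) =
      resH1Hom (ContinuousMonoidHom.id H) ψ hψ (conjH1 H M σ c) :=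
    congrArg (fun f : subgroupH1 H M →+ subgroupH1 H M' ↦ f c) (conjH1_comp_resH1Hom_id H ψ hψ hψ' σ)
  rw [hconj]
  have e := congrArg (fun f : subgroupH1 H M →+ subgroupH1 (H ⊓ D) M' ↦ f (conjH1 H M σ c))
    (resOfLe_comp_resH1Hom_id (inf_le_left : H ⊓ D ≤ H) ψ hψ (fun x m ↦ hψ' x m))
  simp only [AddMonoidHom.comp_apply] at e
  rw [e, hc, map_zero]

omit [NumberField K] [H.Normal] in
/-- `(ψ⁻¹)_* ∘ ψ_* = id` on `H¹(H, M)` for an equivariant isomorphism `ψ` (Literature `resH1Hom_id_symm_comp`, pointwise).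
[cite: SerreGaloisCohomology1997, I §2.4] -/
theorem resH1Hom_id_symm_apply (ψ : M ≃+ M')
    (hψ : ∀ (x : H) (m : M), (ψ : M →+ M') (ContinuousMonoidHom.id H x • m) = x • (ψ : M →+ M') m)
    (hψs : ∀ (x : H) (m : M'), (ψ.symm : M' →+ M) (ContinuousMonoidHom.id H x • m) = x • (ψ.symm : M' →+ M) m)
    (c : subgroupH1 H M) :
    resH1Hom (ContinuousMonoidHom.id H) (ψ.symm : M' →+ M) hψs (resH1Hom (ContinuousMonoidHom.id H) (ψ : M →+ M') hψ c) = c :=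
  congrArg (fun f : subgroupH1 H M →+ subgroupH1 H M ↦ f c) (resH1Hom_id_symm_comp H ψ hψ hψs)

omit [NumberField K] in
/-- **«Locally trivial» along an equivariant ISOMORPHISM, as an iff.** [cite: SerreGaloisCohomology1997, I §2.4–2.5] -/
theorem resOfLe_conjH1_resH1Hom_id_eq_zero_iff (ψ : M ≃+ M') (hψ' : ∀ (g : absoluteGaloisGroup K) (m : M), ψ (g • m) = g • ψ m)
    (hψ : ∀ (x : H) (m : M), (ψ : M →+ M') (ContinuousMonoidHom.id H x • m) = x • (ψ : M →+ M') m)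
    (D : Subgroup (absoluteGaloisGroup K)) (σ : absoluteGaloisGroup K) (c : subgroupH1 H M) :
    resOfLe M' (inf_le_left : H ⊓ D ≤ H) (conjH1 H M' σ (resH1Hom (ContinuousMonoidHom.id H) (ψ : M →+ M') hψ c)) = 0 ↔
      resOfLe M (inf_le_left : H ⊓ D ≤ H) (conjH1 H M σ c) = 0 := by
  have hψs' : ∀ (g : absoluteGaloisGroup K) (m : M'), ψ.symm (g • m) = g • ψ.symm m := fun g m ↦ by
    apply ψ.injective
    rw [ψ.apply_symm_apply, hψ', ψ.apply_symm_apply]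
  have hψs : ∀ (x : H) (m : M'), (ψ.symm : M' →+ M) (ContinuousMonoidHom.id H x • m) = x • (ψ.symm : M' →+ M) m :=
    fun x m ↦ hψs' x m
  refine ⟨fun h ↦ ?_, resOfLe_conjH1_resH1Hom_id_eq_zero H (ψ : M →+ M') (fun g m ↦ hψ' g m) hψ D σ⟩
  have h2 := resOfLe_conjH1_resH1Hom_id_eq_zero H (ψ.symm : M' →+ M) (fun g m ↦ hψs' g m) hψs D σ h
  rwa [resH1Hom_id_symm_apply H ψ hψ hψs] at h2

end Transport

/-! ## §1b The real evaluation under a map of `2`-torsion modules -/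

section Eval

variable {K : Type} [Field K] [NumberField K] (W W' : WeierstrassCurve K) (H : Subgroup (absoluteGaloisGroup K)) [H.Normal]
  (D : Subgroup (absoluteGaloisGroup K))

omit [NumberField K] [H.Normal] in
/-- **`ev(ψ_* z) = ψ(ev z)`**: for `ψ : W[2] → W′[2]` equivariant, `H ⊓ D` acting trivially on both modules and `g ∈ H ⊓ D`, the
evaluation at `g` of the restricted class commutes with `ψ_*` (one cocycle per class; `(ψ ∘ ζ)(g) = ψ(ζ(g))`).
[cite: SerreGaloisCohomology1997, I §2.3–2.4] -/
theorem evalH1_resOfLe_resH1Hom_id (ψ : ↥(W.geomTorsion 2) →+ ↥(W'.geomTorsion 2))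
    (hψ : ∀ (x : H) (m : ↥(W.geomTorsion 2)), ψ (ContinuousMonoidHom.id H x • m) = x • ψ m)
    (htriv : ∀ (g : ↥(H ⊓ D)) (m : ↥(W.geomTorsion 2)), g • m = m)
    (htriv' : ∀ (g : ↥(H ⊓ D)) (m : ↥(W'.geomTorsion 2)), g • m = m) (g : ↥(H ⊓ D))
    (z : subgroupH1 H ↥(W.geomTorsion 2)) :
    evalH1 htriv' g (resOfLe (↥(W'.geomTorsion 2)) (inf_le_left : H ⊓ D ≤ H)
        (resH1Hom (ContinuousMonoidHom.id H) ψ hψ z)) =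
      ψ (evalH1 htriv g (resOfLe (↥(W.geomTorsion 2)) (inf_le_left : H ⊓ D ≤ H) z)) := by
  obtain ⟨ζ, rfl⟩ := oneCocycleClass_surjective _ z
  rw [resH1Hom_oneCocycleClass, RealKummerHom.evalH1_resOfLe_oneCocycleClass_of_le W' inf_le_left htriv' g,
    RealKummerHom.evalH1_resOfLe_oneCocycleClass_of_le W inf_le_left htriv g, pullback_resHomOfEquivariant_apply]
  rfl

omit [NumberField K] in
/-- **The real condition of a conjugate class under `ψ_*`**: `ev(conj_σ (ψ_* y)) = ψ(ev(conj_σ y))` (`ψ_*` commutes with `conj_σ`).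
[cite: SerreGaloisCohomology1997, I §2.5] -/
theorem evalH1_resOfLe_conjH1_resH1Hom_id (ψ : ↥(W.geomTorsion 2) →+ ↥(W'.geomTorsion 2))
    (hψ' : ∀ (g : absoluteGaloisGroup K) (m : ↥(W.geomTorsion 2)), ψ (g • m) = g • ψ m)
    (hψ : ∀ (x : H) (m : ↥(W.geomTorsion 2)), ψ (ContinuousMonoidHom.id H x • m) = x • ψ m)
    (htriv : ∀ (g : ↥(H ⊓ D)) (m : ↥(W.geomTorsion 2)), g • m = m)
    (htriv' : ∀ (g : ↥(H ⊓ D)) (m : ↥(W'.geomTorsion 2)), g • m = m) (g : ↥(H ⊓ D))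
    (σ : absoluteGaloisGroup K) (y : subgroupH1 H ↥(W.geomTorsion 2)) :
    evalH1 htriv' g (resOfLe (↥(W'.geomTorsion 2)) (inf_le_left : H ⊓ D ≤ H)
        (conjH1 H (↥(W'.geomTorsion 2)) σ (resH1Hom (ContinuousMonoidHom.id H) ψ hψ y))) =
      ψ (evalH1 htriv g (resOfLe (↥(W.geomTorsion 2)) (inf_le_left : H ⊓ D ≤ H) (conjH1 H (↥(W.geomTorsion 2)) σ y))) := by
  have hconj : conjH1 H (↥(W'.geomTorsion 2)) σ (resH1Hom (ContinuousMonoidHom.id H) ψ hψ y) =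
      resH1Hom (ContinuousMonoidHom.id H) ψ hψ (conjH1 H (↥(W.geomTorsion 2)) σ y) :=
    congrArg (fun f : subgroupH1 H ↥(W.geomTorsion 2) →+ subgroupH1 H ↥(W'.geomTorsion 2) ↦ f y)
      (conjH1_comp_resH1Hom_id H ψ hψ hψ' σ)
  rw [hconj, evalH1_resOfLe_resH1Hom_id W W' H D ψ hψ htriv htriv' g]

end Eval

/-! ## §2 `E/ℚ`, `p = 2`: the explicit `E[2]`-Selmer group `Q_Gr` is transported by a LETTER-PRESERVING equivariant isomorphism -/

section RatTwo

variable (W W' : WeierstrassCurve ℚ) [W.IsGloballyMinimal] [W.IsElliptic] [W'.IsGloballyMinimal] [W'.IsElliptic]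
  (κ : ZpExtension ℚ 2) {v : HeightOneSpectrum (𝓞 ℚ)}

omit [W.IsElliptic] [W'.IsElliptic] [W.IsGloballyMinimal] in
/-- **`y ∈ Q_Gr(W) ⟺ ψ_* y ∈ Q_Gr(W′)`** for a `Γ_ℚ`-equivariant isomorphism `ψ : W[2] ≃+ W′[2]` MATCHING THE LETTERS: `ψ(C₂[2]) = C₂′[2]`
(hypothesis `hplus` on `E[2]`-data `N`, `N′` with `N′.plus = C₂′[2]`, cf. `RealKummerOrdinary.exists_torsionDatum`) and `ψ T_w = T′_w` (the real
Kummer letters). Here `Q_Gr(W) = {y ∈ H¹(ℚ_∞, W[2]) | (i) locally trivial at every odd place-conjugate, (ii) conj_σ y ∈ C₂[2].greenbergKer ∀σ,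
(iii) ev_w(conj_σ y) ∈ {O, T_w} ∀σ}`. [cite: GreenbergVatsal2000, Thm 1.4 and §2] [cite: GreenbergLNM1716, §2 and §5 p. 168] -/
theorem mem_iff_of_torsionIso (hpv : ((2 : ℕ) : 𝓞 ℚ) ∈ v.asIdeal) (hΔ' : ¬ (2 : ℤ) ∣ minimalDiscriminantInt W')
    (ψ : ↥(W.geomTorsion 2) ≃+ ↥(W'.geomTorsion 2))
    (hψ' : ∀ (g : absoluteGaloisGroup ℚ) (m : ↥(W.geomTorsion 2)), ψ (g • m) = g • ψ m)
    (hψ : ∀ (x : κ.kerSubgroup) (m : ↥(W.geomTorsion 2)), (ψ : ↥(W.geomTorsion 2) →+ ↥(W'.geomTorsion 2)) (ContinuousMonoidHom.id κ.kerSubgroup x • m) = x • (ψ : ↥(W.geomTorsion 2) →+ ↥(W'.geomTorsion 2)) m)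
    (N : LocalDatum ℚ ↥(W.geomTorsion 2) v) (N' : LocalDatum ℚ ↥(W'.geomTorsion 2) v)
    (hN' : ∀ t : ↥(W'.geomTorsion 2), t ∈ N'.plus ↔
      ((AddSubgroup.inclusion (geomTorsion_le_geomPrimaryTorsion W' 2) t : ↥(W'.geomPrimaryTorsion 2)) ∈
        (reductionDatum W' 2 hpv hΔ').plus))
    (hplus : ∀ t : ↥(W.geomTorsion 2), t ∈ N.plus ↔ ψ t ∈ N'.plus)
    (w : InfinitePlace ℚ) (htriv : ∀ (g : ↥(κ.kerSubgroup ⊓ decompInf w)) (m : ↥(W.geomTorsion 2)), g • m = m)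
    (htriv' : ∀ (g : ↥(κ.kerSubgroup ⊓ decompInf w)) (m : ↥(W'.geomTorsion 2)), g • m = m)
    (g : ↥(κ.kerSubgroup ⊓ decompInf w)) {Tw : ↥(W.geomTorsion 2)} {Tw' : ↥(W'.geomTorsion 2)} (hT : ψ Tw = Tw')
    (y : subgroupH1 κ.kerSubgroup ↥(W.geomTorsion 2)) :
    ((∀ (u : HeightOneSpectrum (𝓞 ℚ)), ((2 : ℕ) : 𝓞 ℚ) ∉ u.asIdeal → ∀ σ : absoluteGaloisGroup ℚ,
          resOfLe (↥(W.geomTorsion 2)) (inf_le_left : κ.kerSubgroup ⊓ decomp u ≤ κ.kerSubgroup)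
            (conjH1 κ.kerSubgroup (↥(W.geomTorsion 2)) σ y) = 0) ∧
        (∀ σ : absoluteGaloisGroup ℚ, conjH1 κ.kerSubgroup (↥(W.geomTorsion 2)) σ y ∈ N.greenbergKer κ.kerSubgroup) ∧
        ∀ σ : absoluteGaloisGroup ℚ,
          evalH1 htriv g (resOfLe (↥(W.geomTorsion 2)) (inf_le_left : κ.kerSubgroup ⊓ decompInf w ≤ κ.kerSubgroup)
              (conjH1 κ.kerSubgroup (↥(W.geomTorsion 2)) σ y)) = 0 ∨
            evalH1 htriv g (resOfLe (↥(W.geomTorsion 2)) (inf_le_left : κ.kerSubgroup ⊓ decompInf w ≤ κ.kerSubgroup)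
              (conjH1 κ.kerSubgroup (↥(W.geomTorsion 2)) σ y)) = Tw) ↔
      ((∀ (u : HeightOneSpectrum (𝓞 ℚ)), ((2 : ℕ) : 𝓞 ℚ) ∉ u.asIdeal → ∀ σ : absoluteGaloisGroup ℚ,
          resOfLe (↥(W'.geomTorsion 2)) (inf_le_left : κ.kerSubgroup ⊓ decomp u ≤ κ.kerSubgroup)
            (conjH1 κ.kerSubgroup (↥(W'.geomTorsion 2)) σ (resH1Hom (ContinuousMonoidHom.id κ.kerSubgroup) (ψ : ↥(W.geomTorsion 2) →+ ↥(W'.geomTorsion 2)) hψ y)) = 0) ∧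
        (∀ σ : absoluteGaloisGroup ℚ, conjH1 κ.kerSubgroup (↥(W'.geomTorsion 2)) σ
            (resH1Hom (ContinuousMonoidHom.id κ.kerSubgroup) (ψ : ↥(W.geomTorsion 2) →+ ↥(W'.geomTorsion 2)) hψ y) ∈ N'.greenbergKer κ.kerSubgroup) ∧
        ∀ σ : absoluteGaloisGroup ℚ,
          evalH1 htriv' g (resOfLe (↥(W'.geomTorsion 2)) (inf_le_left : κ.kerSubgroup ⊓ decompInf w ≤ κ.kerSubgroup)
              (conjH1 κ.kerSubgroup (↥(W'.geomTorsion 2)) σ (resH1Hom (ContinuousMonoidHom.id κ.kerSubgroup) (ψ : ↥(W.geomTorsion 2) →+ ↥(W'.geomTorsion 2)) hψ y))) = 0 ∨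
            evalH1 htriv' g (resOfLe (↥(W'.geomTorsion 2)) (inf_le_left : κ.kerSubgroup ⊓ decompInf w ≤ κ.kerSubgroup)
              (conjH1 κ.kerSubgroup (↥(W'.geomTorsion 2)) σ (resH1Hom (ContinuousMonoidHom.id κ.kerSubgroup) (ψ : ↥(W.geomTorsion 2) →+ ↥(W'.geomTorsion 2)) hψ y))) = Tw') := by
  -- inertia acts trivially on `W′[2]/C₂′[2]`
  have htrivN' : ∀ x ∈ inertia v, ∀ m' : ↥(W'.geomTorsion 2), x • m' - m' ∈ N'.plus := by
    intro x hx m'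
    have hincl : AddSubgroup.inclusion (geomTorsion_le_geomPrimaryTorsion W' 2) (x • m' - m') =
        x • AddSubgroup.inclusion (geomTorsion_le_geomPrimaryTorsion W' 2) m' -
          AddSubgroup.inclusion (geomTorsion_le_geomPrimaryTorsion W' 2) m' := by
      rw [map_sub]; rfl
    rw [hN', hincl]
    exact reductionDatum_htriv W' 2 hpv hΔ' x hx _
  refine and_congr ?_ (and_congr ?_ ?_)
  · refine forall_congr' fun u ↦ forall_congr' fun _ ↦ forall_congr' fun σ ↦ ?_
    exact (resOfLe_conjH1_resH1Hom_id_eq_zero_iff κ.kerSubgroup ψ hψ' hψ (decomp u) σ y).symm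
  · refine forall_congr' fun σ ↦ ?_
    have hconj : conjH1 κ.kerSubgroup (↥(W'.geomTorsion 2)) σ (resH1Hom (ContinuousMonoidHom.id κ.kerSubgroup) (ψ : ↥(W.geomTorsion 2) →+ ↥(W'.geomTorsion 2)) hψ y) =
        resH1Hom (ContinuousMonoidHom.id κ.kerSubgroup) (ψ : ↥(W.geomTorsion 2) →+ ↥(W'.geomTorsion 2)) hψ (conjH1 κ.kerSubgroup _ σ y) :=
      congrArg (fun f : subgroupH1 κ.kerSubgroup ↥(W.geomTorsion 2) →+ _ ↦ f y) (conjH1_comp_resH1Hom_id κ.kerSubgroup (ψ : ↥(W.geomTorsion 2) →+ ↥(W'.geomTorsion 2)) hψ hψ' σ)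
    rw [hconj, RealKummerOrdinary.resH1Hom_id_mem_greenbergKer_iff κ.kerSubgroup (ψ : ↥(W.geomTorsion 2) →+ ↥(W'.geomTorsion 2)) hψ' hψ N N' hplus htrivN']
  · refine forall_congr' fun σ ↦ ?_
    rw [evalH1_resOfLe_conjH1_resH1Hom_id W W' κ.kerSubgroup (decompInf w) (ψ : ↥(W.geomTorsion 2) →+ ↥(W'.geomTorsion 2)) hψ' hψ htriv htriv' g σ y, ← hT]
    simp only [AddMonoidHom.coe_coe, EmbeddingLike.map_eq_zero_iff, ψ.injective.eq_iff]

omit [W.IsElliptic] [W'.IsElliptic] in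
/-- **`Q_Gr(W)` finite ⟺ `Q_Gr(W′)` finite** along a letter-preserving `Γ_ℚ`-equivariant isomorphism `ψ : W[2] ≃+ W′[2]` (`ψ_*` and `(ψ⁻¹)_*`
are mutually inverse on `H¹(ℚ_∞, ·)` and exchange the two explicit `E[2]`-Selmer groups, `mem_iff_of_torsionIso` for `ψ` and for `ψ⁻¹`).
[cite: GreenbergVatsal2000, Thm 1.4 and §2 (the residual Selmer group depends only on E[p])] -/
theorem finite_iff_of_torsionIso (hpv : ((2 : ℕ) : 𝓞 ℚ) ∈ v.asIdeal) (hΔ : ¬ (2 : ℤ) ∣ minimalDiscriminantInt W)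
    (hΔ' : ¬ (2 : ℤ) ∣ minimalDiscriminantInt W') (ψ : ↥(W.geomTorsion 2) ≃+ ↥(W'.geomTorsion 2))
    (hψ' : ∀ (g : absoluteGaloisGroup ℚ) (m : ↥(W.geomTorsion 2)), ψ (g • m) = g • ψ m)
    (hψ : ∀ (x : κ.kerSubgroup) (m : ↥(W.geomTorsion 2)), (ψ : ↥(W.geomTorsion 2) →+ ↥(W'.geomTorsion 2)) (ContinuousMonoidHom.id κ.kerSubgroup x • m) = x • (ψ : ↥(W.geomTorsion 2) →+ ↥(W'.geomTorsion 2)) m)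
    (N : LocalDatum ℚ ↥(W.geomTorsion 2) v) (N' : LocalDatum ℚ ↥(W'.geomTorsion 2) v)
    (hN : ∀ t : ↥(W.geomTorsion 2), t ∈ N.plus ↔
      ((AddSubgroup.inclusion (geomTorsion_le_geomPrimaryTorsion W 2) t : ↥(W.geomPrimaryTorsion 2)) ∈
        (reductionDatum W 2 hpv hΔ).plus))
    (hN' : ∀ t : ↥(W'.geomTorsion 2), t ∈ N'.plus ↔
      ((AddSubgroup.inclusion (geomTorsion_le_geomPrimaryTorsion W' 2) t : ↥(W'.geomPrimaryTorsion 2)) ∈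
        (reductionDatum W' 2 hpv hΔ').plus))
    (hplus : ∀ t : ↥(W.geomTorsion 2), t ∈ N.plus ↔ ψ t ∈ N'.plus)
    (w : InfinitePlace ℚ) (htriv : ∀ (g : ↥(κ.kerSubgroup ⊓ decompInf w)) (m : ↥(W.geomTorsion 2)), g • m = m)
    (htriv' : ∀ (g : ↥(κ.kerSubgroup ⊓ decompInf w)) (m : ↥(W'.geomTorsion 2)), g • m = m)
    (g : ↥(κ.kerSubgroup ⊓ decompInf w)) {Tw : ↥(W.geomTorsion 2)} {Tw' : ↥(W'.geomTorsion 2)} (hT : ψ Tw = Tw') :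
    Set.Finite {y : subgroupH1 κ.kerSubgroup ↥(W.geomTorsion 2) |
        ((∀ (u : HeightOneSpectrum (𝓞 ℚ)), ((2 : ℕ) : 𝓞 ℚ) ∉ u.asIdeal → ∀ σ : absoluteGaloisGroup ℚ,
            resOfLe (↥(W.geomTorsion 2)) (inf_le_left : κ.kerSubgroup ⊓ decomp u ≤ κ.kerSubgroup)
              (conjH1 κ.kerSubgroup (↥(W.geomTorsion 2)) σ y) = 0) ∧
          (∀ σ : absoluteGaloisGroup ℚ, conjH1 κ.kerSubgroup (↥(W.geomTorsion 2)) σ y ∈ N.greenbergKer κ.kerSubgroup) ∧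
          ∀ σ : absoluteGaloisGroup ℚ,
            evalH1 htriv g (resOfLe (↥(W.geomTorsion 2)) (inf_le_left : κ.kerSubgroup ⊓ decompInf w ≤ κ.kerSubgroup)
                (conjH1 κ.kerSubgroup (↥(W.geomTorsion 2)) σ y)) = 0 ∨
              evalH1 htriv g (resOfLe (↥(W.geomTorsion 2)) (inf_le_left : κ.kerSubgroup ⊓ decompInf w ≤ κ.kerSubgroup)
                (conjH1 κ.kerSubgroup (↥(W.geomTorsion 2)) σ y)) = Tw)} ↔
      Set.Finite {y' : subgroupH1 κ.kerSubgroup ↥(W'.geomTorsion 2) |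
        ((∀ (u : HeightOneSpectrum (𝓞 ℚ)), ((2 : ℕ) : 𝓞 ℚ) ∉ u.asIdeal → ∀ σ : absoluteGaloisGroup ℚ,
            resOfLe (↥(W'.geomTorsion 2)) (inf_le_left : κ.kerSubgroup ⊓ decomp u ≤ κ.kerSubgroup)
              (conjH1 κ.kerSubgroup (↥(W'.geomTorsion 2)) σ y') = 0) ∧
          (∀ σ : absoluteGaloisGroup ℚ, conjH1 κ.kerSubgroup (↥(W'.geomTorsion 2)) σ y' ∈ N'.greenbergKer κ.kerSubgroup) ∧
          ∀ σ : absoluteGaloisGroup ℚ,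
            evalH1 htriv' g (resOfLe (↥(W'.geomTorsion 2)) (inf_le_left : κ.kerSubgroup ⊓ decompInf w ≤ κ.kerSubgroup)
                (conjH1 κ.kerSubgroup (↥(W'.geomTorsion 2)) σ y')) = 0 ∨
              evalH1 htriv' g (resOfLe (↥(W'.geomTorsion 2)) (inf_le_left : κ.kerSubgroup ⊓ decompInf w ≤ κ.kerSubgroup)
                (conjH1 κ.kerSubgroup (↥(W'.geomTorsion 2)) σ y')) = Tw')} := by
  have hψs' : ∀ (g : absoluteGaloisGroup ℚ) (m : ↥(W'.geomTorsion 2)), ψ.symm (g • m) = g • ψ.symm m := fun g m ↦ by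
    apply ψ.injective
    rw [ψ.apply_symm_apply, hψ', ψ.apply_symm_apply]
  have hψs : ∀ (x : κ.kerSubgroup) (m : ↥(W'.geomTorsion 2)),
      (ψ.symm : ↥(W'.geomTorsion 2) →+ ↥(W.geomTorsion 2)) (ContinuousMonoidHom.id κ.kerSubgroup x • m) = x • (ψ.symm : ↥(W'.geomTorsion 2) →+ ↥(W.geomTorsion 2)) m := fun x m ↦ hψs' x m
  have hplus' : ∀ t : ↥(W'.geomTorsion 2), t ∈ N'.plus ↔ ψ.symm t ∈ N.plus := fun t ↦ by
    rw [hplus, ψ.apply_symm_apply]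
  have hT' : ψ.symm Tw' = Tw := by rw [← hT, ψ.symm_apply_apply]
  set F := resH1Hom (ContinuousMonoidHom.id κ.kerSubgroup) (ψ : ↥(W.geomTorsion 2) →+ ↥(W'.geomTorsion 2)) hψ with hF
  set G := resH1Hom (ContinuousMonoidHom.id κ.kerSubgroup) (ψ.symm : ↥(W'.geomTorsion 2) →+ ↥(W.geomTorsion 2)) hψs with hG
  have hGF : ∀ c, G (F c) = c := fun c ↦ resH1Hom_id_symm_apply κ.kerSubgroup ψ hψ hψs c
  have hFG : ∀ c, F (G c) = c := fun c ↦ by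
    have e := resH1Hom_id_symm_comp κ.kerSubgroup ψ.symm hψs (fun x m ↦ by rw [AddEquiv.symm_symm]; exact hψ x m)
    have e' := congrArg (fun f : subgroupH1 κ.kerSubgroup ↥(W'.geomTorsion 2) →+ subgroupH1 κ.kerSubgroup ↥(W'.geomTorsion 2) ↦ f c) e
    simp only [AddMonoidHom.comp_apply, AddMonoidHom.id_apply] at e'
    rw [hF]
    convert e' using 2
    exact resH1Hom_congr rfl (by rw [AddEquiv.symm_symm]) _ _
  have hmem := mem_iff_of_torsionIso W W' κ hpv hΔ' ψ hψ' hψ N N' hN' hplus w htriv htriv' g hT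
  have hmem' := mem_iff_of_torsionIso W' W κ hpv hΔ ψ.symm hψs' hψs N' N hN hplus' w htriv' htriv g hT'
  constructor
  · intro hfin
    refine (hfin.image F).subset fun c hc ↦ ⟨G c, (hmem' c).1 hc, hFG c⟩
  · intro hfin
    refine (hfin.image G).subset fun c hc ↦ ⟨F c, (hmem c).1 hc, hGF c⟩

omit [W'.IsElliptic] in
/-- **KERNEL SUFFICIENCY across a letter-preserving congruence**: if `Q_Gr(W′)` is finite then `Sel_{2^∞}(W/ℚ_∞)[2]` is finite (`X(W/ℚ_∞)`
torsion with `μ₂ = 0`) — `Δ_W > 0`, `2 ∤ Δ_min(W)`, cyclotomic `κ`, `ψ : W[2] ≃+ W′[2]` equivariant with `ψ(C₂[2]) = C₂′[2]`, `ψ T_w = T′_w`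
(`T_w` the Kummer letter of `W` at `g`). [cite: GreenbergVatsal2000, Thm 1.4] [cite: GreenbergLNM1716, §1 Conj. 1.11, §2, §5 p. 168] -/
theorem finite_twoTorsion_selmerInfty_of_finite_of_torsionIso (hκ : κ.IsCyclotomic) (hΔpos : 0 < W.Δ)
    (hpv : ((2 : ℕ) : 𝓞 ℚ) ∈ v.asIdeal) (hΔ : ¬ (2 : ℤ) ∣ minimalDiscriminantInt W) (hΔ' : ¬ (2 : ℤ) ∣ minimalDiscriminantInt W')
    (ψ : ↥(W.geomTorsion 2) ≃+ ↥(W'.geomTorsion 2))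
    (hψ' : ∀ (g : absoluteGaloisGroup ℚ) (m : ↥(W.geomTorsion 2)), ψ (g • m) = g • ψ m)
    (hψ : ∀ (x : κ.kerSubgroup) (m : ↥(W.geomTorsion 2)), (ψ : ↥(W.geomTorsion 2) →+ ↥(W'.geomTorsion 2)) (ContinuousMonoidHom.id κ.kerSubgroup x • m) = x • (ψ : ↥(W.geomTorsion 2) →+ ↥(W'.geomTorsion 2)) m)
    (N : LocalDatum ℚ ↥(W.geomTorsion 2) v) (N' : LocalDatum ℚ ↥(W'.geomTorsion 2) v)
    (hN : ∀ t : ↥(W.geomTorsion 2), t ∈ N.plus ↔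
      ((AddSubgroup.inclusion (geomTorsion_le_geomPrimaryTorsion W 2) t : ↥(W.geomPrimaryTorsion 2)) ∈
        (reductionDatum W 2 hpv hΔ).plus))
    (hN' : ∀ t : ↥(W'.geomTorsion 2), t ∈ N'.plus ↔
      ((AddSubgroup.inclusion (geomTorsion_le_geomPrimaryTorsion W' 2) t : ↥(W'.geomPrimaryTorsion 2)) ∈
        (reductionDatum W' 2 hpv hΔ').plus))
    (hplus : ∀ t : ↥(W.geomTorsion 2), t ∈ N.plus ↔ ψ t ∈ N'.plus)
    (w : InfinitePlace ℚ) (htriv : ∀ (g : ↥(κ.kerSubgroup ⊓ decompInf w)) (m : ↥(W.geomTorsion 2)), g • m = m)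
    (htriv' : ∀ (g : ↥(κ.kerSubgroup ⊓ decompInf w)) (m : ↥(W'.geomTorsion 2)), g • m = m)
    {g : ↥(κ.kerSubgroup ⊓ decompInf w)} (hg : g ≠ 1) {Tw : ↥(W.geomTorsion 2)} {Tw' : ↥(W'.geomTorsion 2)}
    (hline : ∀ t : ↥(W.geomTorsion 2),
      (∃ a : ↥(W.geomPrimaryTorsion 2), (g : absoluteGaloisGroup ℚ) • a - a =
          AddSubgroup.inclusion (geomTorsion_le_geomPrimaryTorsion W 2) t) ↔ (t = 0 ∨ t = Tw))
    (hT : ψ Tw = Tw')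
    (hfin : Set.Finite {y' : subgroupH1 κ.kerSubgroup ↥(W'.geomTorsion 2) |
        ((∀ (u : HeightOneSpectrum (𝓞 ℚ)), ((2 : ℕ) : 𝓞 ℚ) ∉ u.asIdeal → ∀ σ : absoluteGaloisGroup ℚ,
            resOfLe (↥(W'.geomTorsion 2)) (inf_le_left : κ.kerSubgroup ⊓ decomp u ≤ κ.kerSubgroup)
              (conjH1 κ.kerSubgroup (↥(W'.geomTorsion 2)) σ y') = 0) ∧
          (∀ σ : absoluteGaloisGroup ℚ, conjH1 κ.kerSubgroup (↥(W'.geomTorsion 2)) σ y' ∈ N'.greenbergKer κ.kerSubgroup) ∧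
          ∀ σ : absoluteGaloisGroup ℚ,
            evalH1 htriv' g (resOfLe (↥(W'.geomTorsion 2)) (inf_le_left : κ.kerSubgroup ⊓ decompInf w ≤ κ.kerSubgroup)
                (conjH1 κ.kerSubgroup (↥(W'.geomTorsion 2)) σ y')) = 0 ∨
              evalH1 htriv' g (resOfLe (↥(W'.geomTorsion 2)) (inf_le_left : κ.kerSubgroup ⊓ decompInf w ≤ κ.kerSubgroup)
                (conjH1 κ.kerSubgroup (↥(W'.geomTorsion 2)) σ y')) = Tw')}) :
    Set.Finite {s : W.selmerInfty κ | 2 • s = 0} :=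
  RealKummerOrdinary.finite_twoTorsion_selmerInfty_of_finite W κ hκ hΔpos hpv hΔ N hN w htriv hg hline
    ((finite_iff_of_torsionIso W W' κ hpv hΔ hΔ' ψ hψ' hψ N N' hN hN' hplus w htriv htriv' g hT).2 hfin)

omit [W.IsElliptic] [W'.IsElliptic] in
/-- Uniqueness of the Kummer letter: two letters characterised by the same line coincide. [cite: SilvermanAEC2009, X.1 (Prop. 1.4)] -/
theorem kummerLetter_unique {M : Type} [AddCommGroup M] {line : M → Prop} {T₁ T₂ : M} (h0 : T₁ ≠ 0)
    (h₁ : ∀ t, line t ↔ (t = 0 ∨ t = T₁)) (h₂ : ∀ t, line t ↔ (t = 0 ∨ t = T₂)) : T₁ = T₂ := by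
  rcases (h₂ T₁).1 ((h₁ T₁).2 (Or.inr rfl)) with h | h
  · exact absurd h h0
  · exact h

/-- **THE `p = 2` GREENBERG–VATSAL TRANSFER ON THE `Δ > 0` HALF-CELL (modulo the printed `im κ_𝔭 ⊇ L_𝔭`).** Let `W, W′/ℚ` be globally minimal,
good ORDINARY at `2` (`2 ∤ Δ_min`, `2 ∤ a₂`), with `Δ_W, Δ_{W′} > 0`, `κ` the cyclotomic `ℤ₂`-extension, and `ψ : W[2] ≃+ W′[2]` a `Γ_ℚ`-equivariant
isomorphism MATCHING THE LETTERS — `ψ(C₂[2]) = C₂′[2]` (the 2-adic lines, data `N`, `N′`) and `ψ T_w = T′_w` (the real Kummer letters at a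
complex conjugation `g ∈ ker κ ⊓ D_w`). Then `Sel_{2^∞}(W/ℚ_∞)[2]` is finite iff `Sel_{2^∞}(W′/ℚ_∞)[2]` is finite — i.e. «`X` is `Λ`-torsion with
`μ₂ = 0`» (stub T's conclusion) holds for `W` iff it holds for `W′`. (GV 2000 Thm 1.4 is the odd-`p` statement, where no letters occur; here the
residual Selmer groups are the `Q_Gr` of `RealKummerOrdinary`, identified by `finite_iff_of_torsionIso`; the only printed input is
`GreenbergVatsal2000.imKummer_ge_greenbergCondition_at_p`, hypothesis `hGV`.) [cite: GreenbergVatsal2000, Thm 1.4 and §2 p. 26]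
[cite: GreenbergLNM1716, §2 Props. 2.2–2.4 and §5 p. 168] -/
theorem finite_twoTorsion_selmerInfty_iff_of_torsionIso_of_GV
    (hGV : Literature.NumberTheory.EllipticCurves.GreenbergVatsal2000.imKummer_ge_greenbergCondition_at_p)
    (hκ : κ.IsCyclotomic) (hΔpos : 0 < W.Δ) (hΔpos' : 0 < W'.Δ)
    (hpv : ((2 : ℕ) : 𝓞 ℚ) ∈ v.asIdeal) (hΔ : ¬ (2 : ℤ) ∣ minimalDiscriminantInt W) (hΔ' : ¬ (2 : ℤ) ∣ minimalDiscriminantInt W')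
    (hord : ¬ (2 : ℤ) ∣ W.frobeniusTrace 2) (hord' : ¬ (2 : ℤ) ∣ W'.frobeniusTrace 2)
    (ψ : ↥(W.geomTorsion 2) ≃+ ↥(W'.geomTorsion 2))
    (hψ' : ∀ (g : absoluteGaloisGroup ℚ) (m : ↥(W.geomTorsion 2)), ψ (g • m) = g • ψ m)
    (hψ : ∀ (x : κ.kerSubgroup) (m : ↥(W.geomTorsion 2)), (ψ : ↥(W.geomTorsion 2) →+ ↥(W'.geomTorsion 2)) (ContinuousMonoidHom.id κ.kerSubgroup x • m) = x • (ψ : ↥(W.geomTorsion 2) →+ ↥(W'.geomTorsion 2)) m)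
    (N : LocalDatum ℚ ↥(W.geomTorsion 2) v) (N' : LocalDatum ℚ ↥(W'.geomTorsion 2) v)
    (hN : ∀ t : ↥(W.geomTorsion 2), t ∈ N.plus ↔
      ((AddSubgroup.inclusion (geomTorsion_le_geomPrimaryTorsion W 2) t : ↥(W.geomPrimaryTorsion 2)) ∈
        (reductionDatum W 2 hpv hΔ).plus))
    (hN' : ∀ t : ↥(W'.geomTorsion 2), t ∈ N'.plus ↔
      ((AddSubgroup.inclusion (geomTorsion_le_geomPrimaryTorsion W' 2) t : ↥(W'.geomPrimaryTorsion 2)) ∈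
        (reductionDatum W' 2 hpv hΔ').plus))
    (hplus : ∀ t : ↥(W.geomTorsion 2), t ∈ N.plus ↔ ψ t ∈ N'.plus)
    (w : InfinitePlace ℚ) (htriv : ∀ (g : ↥(κ.kerSubgroup ⊓ decompInf w)) (m : ↥(W.geomTorsion 2)), g • m = m)
    (htriv' : ∀ (g : ↥(κ.kerSubgroup ⊓ decompInf w)) (m : ↥(W'.geomTorsion 2)), g • m = m)
    {g : ↥(κ.kerSubgroup ⊓ decompInf w)} (hg : g ≠ 1) {Tw : ↥(W.geomTorsion 2)} {Tw' : ↥(W'.geomTorsion 2)}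
    (hline : ∀ t : ↥(W.geomTorsion 2),
      (∃ a : ↥(W.geomPrimaryTorsion 2), (g : absoluteGaloisGroup ℚ) • a - a =
          AddSubgroup.inclusion (geomTorsion_le_geomPrimaryTorsion W 2) t) ↔ (t = 0 ∨ t = Tw))
    (hline' : ∀ t : ↥(W'.geomTorsion 2),
      (∃ a : ↥(W'.geomPrimaryTorsion 2), (g : absoluteGaloisGroup ℚ) • a - a =
          AddSubgroup.inclusion (geomTorsion_le_geomPrimaryTorsion W' 2) t) ↔ (t = 0 ∨ t = Tw'))
    (hT : ψ Tw = Tw') :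
    Set.Finite {s : W.selmerInfty κ | 2 • s = 0} ↔ Set.Finite {s : W'.selmerInfty κ | 2 • s = 0} := by
  obtain ⟨T₁, hT₁0, hline₁, hiff₁⟩ :=
    RealKummerOrdinary.finite_twoTorsion_selmerInfty_iff_of_GV W κ hGV hκ hΔpos hpv hΔ hord N hN w htriv hg
  obtain ⟨T₂, hT₂0, hline₂, hiff₂⟩ :=
    RealKummerOrdinary.finite_twoTorsion_selmerInfty_iff_of_GV W' κ hGV hκ hΔpos' hpv hΔ' hord' N' hN' w htriv' hg
  have e₁ : T₁ = Tw := kummerLetter_unique hT₁0 hline₁ hline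
  have e₂ : T₂ = Tw' := kummerLetter_unique hT₂0 hline₂ hline'
  subst e₁ e₂
  exact hiff₁.trans ((finite_iff_of_torsionIso W W' κ hpv hΔ hΔ' ψ hψ' hψ N N' hN hN' hplus w htriv htriv' g hT).trans hiff₂.symm)

end RatTwo

end Summit.BirchSwinnertonDyer.BirchSwinnertonDyer.Theorems.AlignedTransportAtTwoFineRoad.RealKummerCongruence

end
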